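import Summits.CriticalPhenomena.PercolationContinuityZ3.Theorems.PercNearOneGluingNoHeavyQuantLowToZeroMove
import HarnessLib

/-!
# QUANT lane R8, T-DEC, leg (III): the low-to-zero move when the source atom `a` is NOT a low of the new target — a datum-form
# criterion (nonzero lows mid-absorbed + the column of `a`), arbitrary law (typer g28, part 4)

builds on p205010 (kernel theorem, internal audit signed; external expert review pending)

Support file (`--supports stmt-CriticalPhenomena-4575`), QUANT lane typer seat prim-quant-stmt (gen 28), rung R8 of
`run/shared/lean/prim/quant/LADDER.md`.  Theorems only, standard axioms, no sorries, no definitions.  Parts 1–3: `…QuantLowToZeroMove`,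
`…QuantGateMoveBlobDatum`, `…QuantGateMoveBlobCorner` (the case `a` a `t`-low).

THE OTHER REGIME.  Move `ε` from the atom `a` to `0` and lower the target from `τ` to `t ≤ τ`, when `a` is NOT a low of `t` (`j < a`, or
`t ≤ 2a`): then `a` is an ABSORBER of the moved law `P = L + ε(δ₀ − δ_a)` whose capacity shrank by `ε`, and the `t`-lows of `P` are the
`t`-lows of `L` (all `< t/2 ≤ a` when `a ≤ j`).  In typer g27's `flowAtT_gateMoveBlob` this regime is "Case A" under `hsupp` (no nonzero
`t`-low carries mass); with unshifted atoms below the blob it is the open regime "2a ≥ t with lows below a" (GATE-MOVE-BLOB-G27 §7,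
arm-1 g39 TWIN-MOVE-G39 §4: transfer + dump 485 / 486, twin re-route for the rest).
* **`LawDec.flowAtT_lowToZero_of_midAbsorbed_notLow`** — datum form, ARBITRARY law `L` with a flow datum `f` at `(y, τ, j)`: if every
  nonzero `t`-low ships into mids only, the column of `a` at the `t`-rates fits into `L a − ε` (automatic when `a` is a giant or a `τ`-low),
  and `P` is a probability law of mean `t` with `y·N ≤ t`, then `P ∈ FlowAtT(y, t, j)`: keep the mid pairs of the nonzero `t`-lows, finish
  with the first-moment criterion on the remainder (its only charged low is `0`; `gateMoveBlob_remainder`, `flowAtT_of_moment`).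
* **`LawDec.flowAtT_gateMoveBlob_of_datum_notLow`** — (M) in this regime from ANY datum of `slice ν a g` with these two properties.
HONEST STATUS: (M) ∀ a, `GateMove`, `GatedConvEmptyFree`, `SingleGateConvClosed`, `SDECConvClosed`, `TreeDEC`, `FarTreeRow` remain OPEN;
memo `run/shared/lean/prim/quant/prim-quant-stmt-g28/GATE-MOVE-G28.md` §5(c).

[this work]; (M): typer g27; flow normal form typer g22 / lead g21 (this lane).  The gluing rows served [cite: KozmaNitzan2024, Conjecture 3 (p. 15)];
product measure [cite: Grimmett1999, §1.3 p. 10].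
-/

noncomputable section

namespace Summit.CriticalPhenomena.PercolationContinuityZ3.Theorems

namespace Quant

open Finset

namespace LawDec

/-- **THE LOW-TO-ZERO MOVE WHEN `a` IS NOT A `t`-LOW, datum form.**  `0 < y < 1`, `t ≤ τ`, `j < N`, `0 < t`; `a` with `j < a ∨ t ≤ 2a`;
`L` with a flow datum `f` at `(y, τ, j)` in which every nonzero `t`-low ships nothing to the giants and the column of `a` — if `a ≤ j` and
`τ < 2a` — carries at the `t`-rates at most `L a − ε`; the moved law `P = L + ε(δ₀ − δ_a)` a probability law on `{0..N}` of mean `t` with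
`y·N ≤ t`.  Then `P` has a flow at `(y, t, j)`. [this work] -/
theorem flowAtT_lowToZero_of_midAbsorbed_notLow (y τ t ε : ℝ) (a j N : ℕ) (L : ℕ → ℝ) (f : ℕ → ℕ → ℝ)
    (hy0 : 0 < y) (hy1 : y < 1) (htτ : t ≤ τ) (ht0 : 0 < t) (hjN : j < N) (hna : j < a ∨ t ≤ 2 * (a : ℝ))
    (hf : IsFlowAtT y τ j N L f)
    (hP0 : ∀ h, 0 ≤ L h + ε * ((if h = 0 then (1 : ℝ) else 0) - (if h = a then (1 : ℝ) else 0)))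
    (hP1 : ∑ h ∈ Finset.range (N + 1), (L h + ε * ((if h = 0 then (1 : ℝ) else 0) - (if h = a then (1 : ℝ) else 0))) = 1)
    (hPt : ∑ h ∈ Finset.range (N + 1),
      (h : ℝ) * (L h + ε * ((if h = 0 then (1 : ℝ) else 0) - (if h = a then (1 : ℝ) else 0))) = t)
    (hta : y * (N : ℝ) ≤ t)
    (habs : ∀ l h, 1 ≤ l → l ≤ j → 2 * (l : ℝ) < t → j + 1 ≤ h → f l h = 0)
    (hcol : a ≤ j → τ < 2 * (a : ℝ) →
      ∑ l ∈ Finset.range (j + 1), usage y t j l a * (if (1 ≤ l ∧ 2 * (l : ℝ) < t) then f l a else 0) ≤ L a - ε) :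
    FlowAtT y t j N (fun h => L h + ε * ((if h = 0 then (1 : ℝ) else 0) - (if h = a then (1 : ℝ) else 0))) := by
  classical
  obtain ⟨hf0, hfsupp, hfrow, hfcap⟩ := hf
  set P : ℕ → ℝ := fun h => L h + ε * ((if h = 0 then (1 : ℝ) else 0) - (if h = a then (1 : ℝ) else 0)) with hP
  -- a nonzero `t`-low is neither `0` nor `a`
  have hlow_ne : ∀ l : ℕ, 1 ≤ l → l ≤ j → 2 * (l : ℝ) < t → l ≠ 0 ∧ l ≠ a := by
    intro l hl1 hlj hlt
    refine ⟨by omega, ?_⟩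
    rintro rfl
    rcases hna with h1 | h1
    · omega
    · linarith
  have hPoff : ∀ h, h ≠ 0 → h ≠ a → P h = L h := by
    intro h h0 ha
    simp only [hP, if_neg h0, if_neg ha, sub_self, mul_zero, add_zero]
  -- the partial flow: mid pairs of the nonzero `t`-lows
  set φ : ℕ → ℕ → ℝ := fun l m => if (1 ≤ l ∧ l ≤ j ∧ 2 * (l : ℝ) < t ∧ m ≤ j) then f l m else 0 with hφ
  have hφ0 : ∀ l m, 0 ≤ φ l m := by
    intro l m
    simp only [hφ]
    split_ifs
    · exact hf0 l m
    · exact le_rfl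
  have hφle : ∀ l m, φ l m ≤ f l m := by
    intro l m
    simp only [hφ]
    split_ifs
    · exact le_rfl
    · exact hf0 l m
  have hφpos : ∀ l m, 0 < φ l m → (1 ≤ l ∧ l ≤ j ∧ 2 * (l : ℝ) < t ∧ m ≤ j) ∧ 0 < f l m := by
    intro l m hp
    have hc : 1 ≤ l ∧ l ≤ j ∧ 2 * (l : ℝ) < t ∧ m ≤ j := by
      by_contra hc; simp only [hφ, if_neg hc] at hp; exact lt_irrefl _ hp
    refine ⟨hc, ?_⟩
    simp only [hφ, if_pos hc] at hp
    exact hp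
  have hφch : ∀ l m, 0 < φ l m → (1 ≤ l ∧ l ≤ j ∧ 2 * (l : ℝ) < t) ∧ m ≤ j ∧ τ < 2 * (m : ℝ) ∧ t < (l : ℝ) + m := by
    intro l m hp
    obtain ⟨⟨hl1, hlj, hlt, hmj⟩, hfp⟩ := hφpos l m hp
    obtain ⟨_, hl2, _, hc⟩ := hfsupp l m hfp
    have hc' : τ < (l : ℝ) + m := hc.resolve_left (by omega)
    exact ⟨⟨hl1, hlj, hlt⟩, hmj, by linarith, by linarith⟩
  have hφsupp : ∀ l m, 0 < φ l m → l ≤ j ∧ 2 * (l : ℝ) < t ∧ m ≤ N ∧ (j + 1 ≤ m ∨ t < (l : ℝ) + m) := by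
    intro l m hp
    obtain ⟨⟨_, hlj, hlt⟩, hmj, _, hc⟩ := hφch l m hp
    exact ⟨hlj, hlt, by omega, Or.inr hc⟩
  -- rows of `φ`: a nonzero `t`-low ships all of its mass into mids
  have hrow : ∀ l : ℕ, 1 ≤ l → l ≤ j → 2 * (l : ℝ) < t → ∑ m ∈ Finset.range (N + 1), φ l m = L l := by
    intro l hl1 hlj hlt
    rw [← hfrow l hlj (by linarith)]
    refine Finset.sum_congr rfl fun m hm => ?_
    by_cases hmj : m ≤ j
    · simp only [hφ, if_pos (show 1 ≤ l ∧ l ≤ j ∧ 2 * (l : ℝ) < t ∧ m ≤ j from ⟨hl1, hlj, hlt, hmj⟩)]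
    · simp only [hφ, if_neg (show ¬ (1 ≤ l ∧ l ≤ j ∧ 2 * (l : ℝ) < t ∧ m ≤ j) from fun h' => hmj h'.2.2.2)]
      exact (habs l m hl1 hlj hlt (by omega)).symm
  have hφrow : ∀ l : ℕ, 1 ≤ l → l ≤ j → 2 * (l : ℝ) < t → ∑ m ∈ Finset.range (N + 1), φ l m ≤ P l := by
    intro l hl1 hlj hlt
    obtain ⟨h0, ha⟩ := hlow_ne l hl1 hlj hlt
    rw [hrow l hl1 hlj hlt, hPoff l h0 ha]
  -- columns of `φ`
  have hφcol : ∀ h, h ≤ j → τ < 2 * (h : ℝ) → ∑ l ∈ Finset.range (j + 1), usage y t j l h * φ l h ≤ P h := by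
    intro h hhj hτh
    have hh0 : h ≠ 0 := by rintro rfl; push_cast at hτh; linarith
    by_cases hha : h = a
    · -- the column of `a`
      subst hha
      have ePa : P h = L h - ε := by
        simp only [hP, if_neg hh0, if_true]; ring
      rw [ePa]
      refine le_trans (le_of_eq (Finset.sum_congr rfl fun l hl => ?_)) (hcol hhj hτh)
      have hlj : l ≤ j := Nat.lt_succ_iff.1 (Finset.mem_range.1 hl)
      by_cases hc : 1 ≤ l ∧ 2 * (l : ℝ) < t
      · rw [if_pos hc]
        simp only [hφ, if_pos (show 1 ≤ l ∧ l ≤ j ∧ 2 * (l : ℝ) < t ∧ h ≤ j from ⟨hc.1, hlj, hc.2, hhj⟩)]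
      · rw [if_neg hc]
        simp only [hφ, if_neg (show ¬ (1 ≤ l ∧ l ≤ j ∧ 2 * (l : ℝ) < t ∧ h ≤ j) from fun h' => hc ⟨h'.1, h'.2.2.1⟩)]
    · rw [hPoff h hh0 hha]
      refine le_trans (Finset.sum_le_sum fun l _ => ?_) (hfcap h (by omega) (Or.inr hτh.le))
      rcases (hφ0 l h).eq_or_lt with hz | hp
      · rw [← hz, mul_zero]
        rcases (hf0 l h).eq_or_lt with hz' | hp'
        · rw [← hz', mul_zero]
        · obtain ⟨_, hl2, _, hc⟩ := hfsupp l h hp'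
          have hlh : l < h := by
            rcases hc with hc | hc
            · omega
            · exact_mod_cast (show (l : ℝ) < h by linarith)
          exact mul_nonneg (usage_pos_of_compat y τ j l h hy0 hy1 hl2 hlh hc).le hp'.le
      · obtain ⟨⟨_, hlj, hlt⟩, _, _, hc⟩ := hφch l h hp
        obtain ⟨_, hfp⟩ := hφpos l h hp
        obtain ⟨_, _, _, hcτ⟩ := hfsupp l h hfp
        have hlh : l < h := by exact_mod_cast (show (l : ℝ) < h by linarith)
        calc usage y t j l h * φ l h ≤ usage y τ j l h * φ l h :=
              mul_le_mul_of_nonneg_right (usage_le_of_target_le y t τ j l h hy0 hy1 htτ hlt hlh hcτ) hp.le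
          _ ≤ usage y τ j l h * f l h :=
              mul_le_mul_of_nonneg_left (hφle l h) (usage_pos_of_compat y τ j l h hy0 hy1 (by linarith) hlh hcτ).le
  -- the remainder
  obtain ⟨hR0, hRrow, hRcol, hRmean⟩ := gateMoveBlob_remainder y t τ j N P φ hy0 hy1 htτ hjN hP0 hP1 hPt hta
    hφ0 hφch hφrow hφcol
  set Rem : ℕ → ℝ := fun h => P h - ∑ m ∈ Finset.range (N + 1), φ h m
    - ∑ l ∈ Finset.range (j + 1), usage y t j l h * φ l h with hRem
  have hRlow : ∀ l, 1 ≤ l → l ≤ j → 2 * (l : ℝ) < t → Rem l = 0 := by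
    intro l hl1 hlj hlt
    have hc : ¬ (l ≤ j ∧ τ < 2 * (l : ℝ)) := fun h' => by linarith [h'.2]
    obtain ⟨h0, ha⟩ := hlow_ne l hl1 hlj hlt
    simp only [hRem]
    rw [hRcol l hc, sub_zero, hrow l hl1 hlj hlt, hPoff l h0 ha, sub_self]
  obtain ⟨g', hg'⟩ := flowAtT_of_moment y t j N Rem hy0 hy1 ht0 hR0 hRlow hta hRmean
  exact ⟨_, isFlowAtT_of_partial hφ0 hφsupp hg'⟩

/-- **THE BLOB GATE MOVE FROM A DATUM WHEN THE BLOB ATOM IS NOT A `t`-LOW.**  Setting of typer g27's `flowAtT_gateMoveBlob` WITHOUT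
`hsupp`, in the regime `j < a ∨ t ≤ 2a` (`t = S + ag − zag`): if `slice ν a g` has a flow datum `f` at `(y, S + ag, j)` in which every
nonzero `t`-low ships into mids only and the column of `a` at the `t`-rates fits into `slice ν a g a − gz` (asked only when `a ≤ j` and
`S + ag < 2a`), then the moved law has a flow at `(y, t, j)`. [this work] -/
theorem flowAtT_gateMoveBlob_of_datum_notLow (y z g S : ℝ) (a j M : ℕ) (ν : ℕ → ℝ) (f : ℕ → ℕ → ℝ)
    (hy0 : 0 < y) (hy1 : y < 1) (hz0 : 0 ≤ z) (hg1 : g ≤ 1) (hyg : y ≤ (1 - z) * g) (ha : 1 ≤ a)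
    (hν0 : ∀ h, 0 ≤ ν h) (hνM : ∀ h, M < h → ν h = 0) (hν1 : ∑ h ∈ Finset.range (M + 1), ν h = 1)
    (hS : S = ∑ h ∈ Finset.range (M + 1), (h : ℝ) * ν h) (hta : y * (M : ℝ) ≤ S) (hzν : z ≤ ν 0)
    (hjN : j < M + a) (hna : j < a ∨ S + (a : ℝ) * g - z * (a : ℝ) * g ≤ 2 * (a : ℝ))
    (hf : IsFlowAtT y (S + (a : ℝ) * g) j (M + a) (slice ν a g) f)
    (habs : ∀ l h, 1 ≤ l → l ≤ j → 2 * (l : ℝ) < S + (a : ℝ) * g - z * (a : ℝ) * g → j + 1 ≤ h → f l h = 0)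
    (hcol : a ≤ j → S + (a : ℝ) * g < 2 * (a : ℝ) →
      ∑ l ∈ Finset.range (j + 1), usage y (S + (a : ℝ) * g - z * (a : ℝ) * g) j l a *
        (if (1 ≤ l ∧ 2 * (l : ℝ) < S + (a : ℝ) * g - z * (a : ℝ) * g) then f l a else 0) ≤ slice ν a g a - g * z) :
    FlowAtT y (S + (a : ℝ) * g - z * (a : ℝ) * g) j (M + a)
      (fun h => slice ν a g h + g * z * ((if h = 0 then (1 : ℝ) else 0) - (if h = a then (1 : ℝ) else 0))) := by
  set τ : ℝ := S + (a : ℝ) * g with hτ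
  set t : ℝ := S + (a : ℝ) * g - z * (a : ℝ) * g with ht
  have hz1 : z ≤ 1 := by
    have h0 := Finset.single_le_sum (fun h _ => hν0 h) (Finset.mem_range.2 (Nat.succ_pos M))
    rw [hν1] at h0
    exact hzν.trans h0
  have hg0 : 0 < g := by
    by_contra hc
    have : (1 - z) * g ≤ 0 := mul_nonpos_of_nonneg_of_nonpos (by linarith) (not_lt.1 hc)
    linarith
  have ha0 : (0 : ℝ) < a := by exact_mod_cast ha
  have hzag : 0 ≤ z * (a : ℝ) * g := mul_nonneg (mul_nonneg hz0 ha0.le) hg0.le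
  have hS0 : 0 ≤ S := by rw [hS]; exact Finset.sum_nonneg fun h _ => mul_nonneg (Nat.cast_nonneg h) (hν0 h)
  have htτ : t ≤ τ := by rw [ht, hτ]; linarith
  have ht0 : 0 < t := by
    rw [ht]
    have : y * (a : ℝ) ≤ (1 - z) * g * a := mul_le_mul_of_nonneg_right hyg ha0.le
    nlinarith [mul_pos hy0 ha0]
  have htaN : y * ((M + a : ℕ) : ℝ) ≤ t := by
    rw [ht]; push_cast
    have : y * (a : ℝ) ≤ (1 - z) * g * a := mul_le_mul_of_nonneg_right hyg ha0.le
    nlinarith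
  obtain ⟨hP0, hPM, hP1, hPt⟩ := moved_laws ν a M g z ha hg0.le hg1 hz0 hzν hν0 hνM hν1
  have hPt' : ∑ h ∈ Finset.range (M + a + 1),
      (h : ℝ) * (slice ν a g h + g * z * ((if h = 0 then (1 : ℝ) else 0) - (if h = a then (1 : ℝ) else 0))) = t := by
    rw [hPt, ← hS, ht]
  exact flowAtT_lowToZero_of_midAbsorbed_notLow y τ t (g * z) a j (M + a) (slice ν a g) f hy0 hy1 htτ ht0 hjN hna hf
    hP0 hP1 hPt' htaN habs hcol

end LawDec

end Quant

end Summit.CriticalPhenomena.PercolationContinuityZ3.Theorems
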